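import Literature.AlgebraicGeometry.Modules.EpiOfSameRankIsIso
import Literature.AlgebraicGeometry.Modules.DetClassOfIso
import Literature.AlgebraicGeometry.Modules.MorphismRankLoci
import Literature.AlgebraicGeometry.Modules.IsZeroOfAffineCover
import Literature.RingTheory.FittingIdeal.SupportBaseChange
import Mathlib.CategoryTheory.Preadditive.Basic
import HarnessLib

/-!
# The iso-locus of a morphism between modules of the same rank is represented by an open subscheme

Topic `AlgebraicGeometry/Modules`; namespace `Literature.AlgebraicGeometry.Modules`.  THEOREMS ONLY (no definition, no instance,
no notation, no named fact, no `sorry`).  Sequel of ★ `Modules/MorphismRankLoci` (B-p21 (g17), the rank loci of a morphism `φ` as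
Fitting loci of `coker φ`) and ★ `Modules/LocallyFreeRankLocusRepresentable` (B-p09 (g14), Stacks 05P8): for a morphism `u : E ⟶ F`
of `𝒪_S`-modules OF THE SAME RANK (`HasRank E n`, `HasRank F n`):

* §1 `isIso_iff_epi_of_hasRank` / `isIso_pullback_map_iff_epi` (★ `isIso_of_epi_of_hasRank`, [Matsumura1987, Thm. 2.4]),
  `epi_iff_isZero_cokernel`, `isZero_iff_fittingIdealSheaf_zero_eq_top` (Stacks 07ZA on the affine opens, ★ `IsAffineLocalizing.isZero_of_cover`);
* §2 **`isIso_pullback_map_iff_fittingIdealSheaf_cokernel_eq_top`** — `g^*u` iso ⟺ `Fit₀(coker (g^*u)) = 𝒪_T`;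
  **`exists_subfunctor_isoLocus`** — the `g : T ⟶ S` with `g^*u` an isomorphism form a sub-functor of `h_S`;
  **`exists_iso_yoneda_isoLocus`** — it is represented by the OPEN subscheme `S ∖ Supp (coker u)` compatibly with the inclusions;
  `range_eq_of_isoLocus` — any classifying morphism (an open immersion: ★ `isOpenImmersion_of_rankLE` with
  `mem_isoLocus_iff_fittingIdealSheaf_pullback_cokernel_eq_top` as its `hP`) has image `S ∖ Supp (coker u)`;
  `exists_subfunctor_isoLocus_of_hasRank` (hypotheses in `HasRank` form).

Consumer (cell `hodgecm-mathlib`, F-DAG F-6 (VI) «the embedding is the complete linear system», MFK Prop. 7.3 step (VI) p. 134): with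
`u : 𝒪_T^{m+1} = 𝒪_T ⊗ H⁰(ℙ^m, 𝒪(1)) → π_*L` and (hbc) «`π_*L` finite locally free of rank `m+1`, formation commutes with base change» the
locus where `H⁰(𝒪(1)) ⊗ κ(t) → H⁰(A_t, L_t)` is an isomorphism is the open subscheme above (census `B-provers/B-p18/g18/CENSUS-F6-VI-IsoLocus.B-p18g18.md`).
[StacksProject, Tags 05P8, 07ZA, 0C3D]; [GortzWedhorn2020, Thm. 8.9 (p. 212)]; [Matsumura1987, Theorem 2.4]; [Hartshorne1977, II §5 (p. 109)].
Count-neutral Mathlib-side capital; nothing here is about HC — HC_CM is proved only modulo the 7 printed citations until rung 0 closes.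
-/

noncomputable section
-- `TopCat.Presheaf`/`Scheme.Modules` are not reducible (as in Mathlib's `AlgebraicGeometry/Modules/Tilde.lean`).
set_option backward.isDefEq.respectTransparency false

open CategoryTheory AlgebraicGeometry Limits TopologicalSpace Opposite

namespace Literature.AlgebraicGeometry.Modules

open Literature.AlgebraicGeometry.Motives Literature.AlgebraicGeometry.Morphisms

universe u

variable {S : Scheme.{u}} {E F : S.Modules} (u : E ⟶ F)

/-! ## §1 Same rank: iso ⟺ epi ⟺ cokernel zero ⟺ `Fit₀(coker) = 𝒪` -/

/-- **Between modules of the same constant rank, a morphism is an isomorphism iff it is an epimorphism**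
(★ `isIso_of_epi_of_hasRank`). [cite: Matsumura1987, Theorem 2.4 (PDF p. 18)] -/
theorem isIso_iff_epi_of_hasRank {n : ℕ} (hE : HasRank E n) (hF : HasRank F n) : IsIso u ↔ Epi u :=
  ⟨fun _ => inferInstance, fun _ => isIso_of_epi_of_hasRank u hE hF⟩

/-- Pulled back along any `g : T ⟶ S`, `g^*u` is an isomorphism iff it is an epimorphism (ranks are preserved by pull-back,
★ `hasRank_pullback`). [cite: Matsumura1987, Theorem 2.4 (PDF p. 18)] -/
theorem isIso_pullback_map_iff_epi {n : ℕ} (hE : HasRank E n) (hF : HasRank F n) {T : Scheme.{u}} (g : T ⟶ S) :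
    IsIso ((Scheme.Modules.pullback g).map u) ↔ Epi ((Scheme.Modules.pullback g).map u) :=
  isIso_iff_epi_of_hasRank _ (hasRank_pullback g hE) (hasRank_pullback g hF)

/-- A morphism of `𝒪_S`-modules is an epimorphism iff its cokernel is zero. [cite: Hartshorne1977, II §5 (p. 109)] -/
theorem epi_iff_isZero_cokernel : Epi u ↔ IsZero (cokernel u) :=
  ⟨fun _ => isZero_cokernel_of_epi u, Preadditive.epi_of_isZero_cokernel u⟩

/-- A zero module has only the zero section. [cite: Hartshorne1977, II §5 (p. 109)] -/
theorem app_eq_zero_of_isZero {Q : S.Modules} (hQ : IsZero Q) (V : S.Opens) (x : Γ(Q, V)) : x = 0 := by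
  have h : (𝟙 Q : Q ⟶ Q) = 0 := hQ.eq_of_src _ _
  have hx : (𝟙 Q : Q ⟶ Q).app V x = (0 : Q ⟶ Q).app V x := by rw [h]
  rwa [Scheme.Modules.Hom.id_app, Scheme.Modules.Hom.zero_app] at hx

/-- **An affine-localizing module of affine-finite type is zero iff its zeroth Fitting ideal sheaf is `𝒪_S`** (Stacks 07ZA on every
affine open + ★ `isZero_of_cover`). [cite: StacksProject, Tag 07ZA] [cite: StacksProject, Tag 0C3G] -/
theorem isZero_iff_fittingIdealSheaf_zero_eq_top {Q : S.Modules} (hQ : IsAffineLocalizing Q) (hfin : IsAffineFiniteType Q) :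
    IsZero Q ↔ fittingIdealSheaf Q hQ hfin 0 = ⊤ := by
  rw [fittingIdealSheaf_eq_top_iff]
  constructor
  · intro h V
    rw [Literature.RingTheory.FittingIdeal.Module.fittingIdeal_zero_eq_top_iff]
    exact ⟨fun x y => by rw [app_eq_zero_of_isZero h V x, app_eq_zero_of_isZero h V y]⟩
  · intro h
    refine hQ.isZero_of_cover (fun V : S.affineOpens => (V : S.Opens)) (fun V => V.2)
      (top_le_iff.mp fun s _ => ?_) fun V x => ?_
    · obtain ⟨W, hW, hsW, -⟩ := Opens.isBasis_iff_nbhd.mp S.isBasis_affineOpens (Opens.mem_top s)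
      exact Opens.mem_iSup.mpr ⟨⟨W, hW⟩, hsW⟩
    · haveI : Subsingleton Γ(Q, (V : S.Opens)) := (Literature.RingTheory.FittingIdeal.Module.fittingIdeal_zero_eq_top_iff).mp (h V)
      exact Subsingleton.elim _ _

/-! ## §2 The iso-locus sub-functor of `h_S` and its representing open subscheme (over ★ `MorphismRankLoci`) -/

section Locus

variable (hE : IsAffineLocalizing E) (hF : IsAffineLocalizing F) (hFf : IsAffineFiniteType F) {n : ℕ}
  (hEn : HasRank E n) (hFn : HasRank F n)

include hEn hFn in
/-- **`g^*u` is an isomorphism iff `Fit₀(coker (g^*u)) = 𝒪_T`** (same rank: iso ⟺ epi ⟺ cokernel zero ⟺ Stacks 07ZA).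
[cite: StacksProject, Tag 07ZA] [cite: Matsumura1987, Theorem 2.4 (PDF p. 18)] -/
theorem isIso_pullback_map_iff_fittingIdealSheaf_cokernel_eq_top {T : Scheme.{u}} (g : T ⟶ S) :
    IsIso ((Scheme.Modules.pullback g).map u) ↔
      fittingIdealSheaf (cokernel ((Scheme.Modules.pullback g).map u)) (isAffineLocalizing_cokernel_map_pullback u hE hF g)
        (isAffineFiniteType_cokernel_map_pullback u hE hF hFf g) 0 = ⊤ := by
  rw [isIso_pullback_map_iff_epi u hEn hFn g, epi_iff_isZero_cokernel, isZero_iff_fittingIdealSheaf_zero_eq_top]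

include hEn hFn in
/-- The same, read on `g^*(coker u)` (★ `fittingIdealSheaf_cokernel_map_pullback`: `Fit₀(coker (g^*u)) = Fit₀(g^*(coker u))`).
[cite: StacksProject, Tag 0C3D] -/
theorem isIso_pullback_map_iff_fittingIdealSheaf_pullback_cokernel_eq_top {T : Scheme.{u}} (g : T ⟶ S) :
    IsIso ((Scheme.Modules.pullback g).map u) ↔
      fittingIdealSheaf ((Scheme.Modules.pullback g).obj (cokernel u)) ((IsAffineLocalizing.cokernel u hE hF).pullback g)
        ((IsAffineFiniteType.cokernel u hE hF hFf).pullback g (IsAffineLocalizing.cokernel u hE hF)) 0 = ⊤ := by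
  rw [isIso_pullback_map_iff_fittingIdealSheaf_cokernel_eq_top u hE hF hFf hEn hFn g,
    fittingIdealSheaf_cokernel_map_pullback u hE hF hFf g 0]

include hE hF hFf hEn hFn in
/-- **THE ISO-LOCUS SUB-FUNCTOR**: the `g : T ⟶ S` with `g^*u` an isomorphism form a sub-functor of `h_S` (it is the «`Fit₀(coker) = 𝒪`»
sub-functor of ★ `exists_subfunctor_cokerRankLE` at `k = 0`). [cite: StacksProject, Tag 05P8] -/
theorem exists_subfunctor_isoLocus :
    ∃ P : Subfunctor (yoneda.obj S), ∀ {T : Scheme.{u}} (g : T ⟶ S),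
      g ∈ P.obj (op T) ↔ IsIso ((Scheme.Modules.pullback g).map u) := by
  obtain ⟨P, hP⟩ := exists_subfunctor_cokerRankLE u hE hF hFf 0
  exact ⟨P, fun g => by rw [hP, isIso_pullback_map_iff_fittingIdealSheaf_cokernel_eq_top u hE hF hFf hEn hFn g]⟩

variable (P : Subfunctor (yoneda.obj S))
  (hP : ∀ {T : Scheme.{u}} (g : T ⟶ S), g ∈ P.obj (op T) ↔ IsIso ((Scheme.Modules.pullback g).map u))

include hEn hFn hP in
/-- Membership in the iso-locus sub-functor, in the `Fit₀(coker (g^*u)) = 𝒪` currency of ★ `MorphismRankLoci`.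
[cite: StacksProject, Tag 05P8] -/
theorem mem_isoLocus_iff_fittingIdealSheaf_cokernel_eq_top {T : Scheme.{u}} (g : T ⟶ S) :
    g ∈ P.obj (op T) ↔
      fittingIdealSheaf (cokernel ((Scheme.Modules.pullback g).map u)) (isAffineLocalizing_cokernel_map_pullback u hE hF g)
        (isAffineFiniteType_cokernel_map_pullback u hE hF hFf g) 0 = ⊤ := by
  rw [hP, isIso_pullback_map_iff_fittingIdealSheaf_cokernel_eq_top u hE hF hFf hEn hFn g]

include hEn hFn hP in
/-- Membership in the iso-locus sub-functor, in the `Fit₀(g^*(coker u)) = 𝒪` currency of ★ `LocallyFreeRankLocusRepresentable`.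
[cite: StacksProject, Tag 05P8] -/
theorem mem_isoLocus_iff_fittingIdealSheaf_pullback_cokernel_eq_top {T : Scheme.{u}} (g : T ⟶ S) :
    g ∈ P.obj (op T) ↔
      fittingIdealSheaf ((Scheme.Modules.pullback g).obj (cokernel u)) ((IsAffineLocalizing.cokernel u hE hF).pullback g)
        ((IsAffineFiniteType.cokernel u hE hF hFf).pullback g (IsAffineLocalizing.cokernel u hE hF)) 0 = ⊤ := by
  rw [hP, isIso_pullback_map_iff_fittingIdealSheaf_pullback_cokernel_eq_top u hE hF hFf hEn hFn g]

include hEn hFn hP in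
/-- **THE ISO-LOCUS IS REPRESENTED BY THE OPEN SUBSCHEME `S ∖ Supp (coker u)`** (precisely `S ∖ Z₀(𝟙^*(coker u))`,
`Z₀ = Supp(𝒪_S / Fit₀)`), compatibly with the inclusions into `h_S` (★ `exists_iso_yoneda_compl_support_cokerRankLE` at `k = 0`).
[cite: StacksProject, Tag 05P8] [cite: GortzWedhorn2020, Thm. 8.9 (p. 212)] -/
theorem exists_iso_yoneda_isoLocus :
    ∃ e : yoneda.obj ((fittingIdealSheaf ((Scheme.Modules.pullback (𝟙 S)).obj (cokernel u))
        ((IsAffineLocalizing.cokernel u hE hF).pullback (𝟙 S))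
        ((IsAffineFiniteType.cokernel u hE hF hFf).pullback (𝟙 S) (IsAffineLocalizing.cokernel u hE hF))
        0).support.compl : Scheme.{u}) ≅ P.toFunctor,
      e.hom ≫ P.ι = yoneda.map (Scheme.Opens.ι _) ≫ (Iso.refl (yoneda.obj S)).hom :=
  exists_iso_yoneda_compl_support_cokerRankLE u hE hF hFf 0 P
    (fun g => mem_isoLocus_iff_fittingIdealSheaf_cokernel_eq_top u hE hF hFf hEn hFn P hP g)

-- The classifying morphism `g : Y ⟶ S` of ANY pair `(Y, e : h_Y ≅ P)` representing the iso-locus is an OPEN IMMERSION: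
-- ★ `isOpenImmersion_of_rankLE (IsAffineLocalizing.cokernel u hE hF) (IsAffineFiniteType.cokernel u hE hF hFf) 0 P
--     (fun g => mem_isoLocus_iff_fittingIdealSheaf_pullback_cokernel_eq_top u hE hF hFf hEn hFn P hP g) e g hg`
-- (not restated: the gate's dedup lint identifies the wrapper with ★ `isOpenImmersion_of_rankLE`).

include hEn hFn hP in
/-- The image of the classifying morphism of any scheme representing the iso-locus is `S ∖ Z₀(𝟙^*(coker u))` — the open set of
points where `coker u` vanishes, i.e. where `u ⊗ κ(s)` is onto (hence an isomorphism). [cite: StacksProject, Tag 05P8] -/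
theorem range_eq_of_isoLocus {Y : Scheme.{u}} (e : yoneda.obj Y ≅ P.toFunctor) (g : Y ⟶ S)
    (hg : yoneda.map g ≫ (Iso.refl (yoneda.obj S)).hom = e.hom ≫ P.ι) :
    Set.range g.base = ((fittingIdealSheaf ((Scheme.Modules.pullback (𝟙 S)).obj (cokernel u))
        ((IsAffineLocalizing.cokernel u hE hF).pullback (𝟙 S))
        ((IsAffineFiniteType.cokernel u hE hF hFf).pullback (𝟙 S) (IsAffineLocalizing.cokernel u hE hF))
        0).support.compl : Set S) :=
  range_eq_of_cokerRankLE u hE hF hFf 0 P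
    (fun g => mem_isoLocus_iff_fittingIdealSheaf_cokernel_eq_top u hE hF hFf hEn hFn P hP g) e g hg

/-- The iso-locus sub-functor for morphisms between modules of the SAME RANK, hypotheses in `HasRank` form only (finite locally
free modules are affine-localizing of affine-finite type). [cite: StacksProject, Tag 05P8] -/
theorem exists_subfunctor_isoLocus_of_hasRank {n : ℕ} (hEn : HasRank E n) (hFn : HasRank F n) :
    ∃ P : Subfunctor (yoneda.obj S), ∀ {T : Scheme.{u}} (g : T ⟶ S),
      g ∈ P.obj (op T) ↔ IsIso ((Scheme.Modules.pullback g).map u) :=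
  exists_subfunctor_isoLocus u (coh_of_isVectorBundle (HasRank.isFiniteLocallyFree' hEn).isVectorBundle).loc
    (coh_of_isVectorBundle (HasRank.isFiniteLocallyFree' hFn).isVectorBundle).loc
    (coh_of_isVectorBundle (HasRank.isFiniteLocallyFree' hFn).isVectorBundle).ft hEn hFn

end Locus

end Literature.AlgebraicGeometry.Modules

end
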